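import Literature.NumberTheory.EllipticCurves.ZpExtensionGaloisTwistWeilDual
import Literature.NumberTheory.EllipticCurves.GreenbergSelmer
import HarnessLib

/-!
# Route UniversalToricDescent — Greenberg's twisted descent, the local invariant bound at the strict prime: the twisted
# `Γ_{K_𝔭}`-invariants of `E[p^J](χ_u)^D` die under `p^{m₀}` when `E(K̄)[p^∞]^{D_𝔭 ∩ Gal(K̄/K_∞)}` does (Greenberg p. 125
# «`H⁰(F_{v₀}, M^*)` is finite»), through the twisted Weil duality `E[p^J](χ_u)^D ≅ E[p^J](χ_{u'})`

Lead prover bsd-wall-utd-p1 g14 (`--supports` ♭T′ stmt-BirchSwinnertonDyer-26975; line `sigmacongruence` v3, brick L3 = the hypothesis `hinv` of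
`…TwistedBaseLift.exists_twistedLift_strict`). For `m = w(T) ∈ Hom(E[p^J], μ_{p^J})` fixed by the Tate-dual action of every
`σ ∈ Γ_{K_𝔭}`: `T` is fixed by the `χ_{u'}`-twisted action of every element of `D_𝔭` (equivariance + injectivity of `w`), in
particular PLAINLY fixed by `D_𝔭 ∩ ker κ` (the twist is invisible there), so `p^{m₀} T = 0` by the local tower torsion bound,
and `p^{m₀} m = w(p^{m₀} T) = 0`. J-INDEPENDENT bound, as Greenberg's argument requires.

* §1 `twisted_tateDual_invariants_smul_eq_zero` — the bound, with the Weil data and the local tower torsion exponent as hypotheses.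

HONEST STATUS: helper theorem (plumbing). THEOREMS ONLY; no definition, no named fact, no `sorry`. BSD is not advanced by this file.
References: [GreenbergLNM1716] §4 p. 125; [MilneADT2006] Ch. I §6; [SilvermanAEC2009] III.8.1.
-/

set_option autoImplicit false
-- `…BirchSwinnertonDyer.BirchSwinnertonDyer.Theorems…` is the problem's mandated namespace (D-0017).
set_option linter.dupNamespace false

noncomputable section
open scoped Classical

namespace Summit.BirchSwinnertonDyer.BirchSwinnertonDyer.Theorems.UniversalToricDescentTwistedDescent

open NumberField IsDedekindDomain Field WeierstrassCurve
  Literature.NumberTheory.EllipticCurves Literature.NumberTheory.GaloisRepresentations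
  Literature.NumberTheory.EllipticCurves.GreenbergSelmer
open Literature.NumberTheory.GaloisRepresentations.DiscreteGaloisModule (TateDual)

universe u

variable {K : Type u} [Field K] [NumberField K] (W : WeierstrassCurve K) [W.IsElliptic] (p : ℕ) [Fact p.Prime]
  (κ : ZpExtension K p) (J : ℕ) {u u' : ℤ}
  (hu : (p : ℤ) ∣ u - 1) (hu' : (p : ℤ) ∣ u' - 1) (huu' : ((p : ℤ) ^ J) ∣ u * u' - 1)
  (e : W.geomTorsion ((p ^ J : ℕ) : ℤ) → W.geomTorsion ((p ^ J : ℕ) : ℤ) → AlgebraicClosure K)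
  (hμ : ∀ S T, e S T ^ (p ^ J) = 1)
  (hadd₁ : ∀ S₁ S₂ T, e (S₁ + S₂) T = e S₁ T * e S₂ T)
  (hadd₂ : ∀ S T₁ T₂, e S (T₁ + T₂) = e S T₁ * e S T₂)
  (hgal : ∀ (σ : absoluteGaloisGroup K) (S T : W.geomTorsion ((p ^ J : ℕ) : ℤ)),
    σ • e S T = e (σ • S) (σ • T))
  (hnondeg : ∀ T, (∀ S, e S T = 1) → T = 0)
  [Finite (W.geomTorsion ((p ^ J : ℕ) : ℤ))] [CharZero K]

include hu' huu' hμ hadd₁ hadd₂ hgal hnondeg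

/-- **The twisted `Γ_{K_𝔭}`-invariants of `E[p^J](χ_u)^D` are killed by `p^{m₀}`** when `p^{m₀}` kills every point of `E(K̄)[p^∞]` fixed
by `D_𝔭 ∩ Gal(K̄/K_∞)` (local tower torsion exponent; `J`-independent). [cite: GreenbergLNM1716, §4 p. 125] [cite: MilneADT2006, Ch. I §6] -/
theorem twisted_tateDual_invariants_smul_eq_zero (𝔭 : HeightOneSpectrum (𝓞 K)) {m₀ : ℕ}
    (hm₀ : ∀ T : W.geomPrimaryTorsion p,
      (∀ d : absoluteGaloisGroup K, d ∈ decomp 𝔭 → d ∈ κ.kerSubgroup → d • T = T) → p ^ m₀ • T = 0)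
    (m : TateDual K (W.geomTorsion ((p ^ J : ℕ) : ℤ)) (p ^ J))
    (hm : ∀ σ : absoluteGaloisGroup (𝔭.adicCompletion K),
      (W.twistedTorsionGaloisModule p κ J u hu).tateDual (p ^ J) (absGaloisRestrict K (𝔭.adicCompletion K) σ) m = m) :
    ((p ^ m₀ : ℕ) : ℤ) • m = 0 := by
  -- `m = w T`
  obtain ⟨T, rfl⟩ := (W.twistedWeilDual_bijective p κ J hu hu' huu' e hμ hadd₁ hadd₂ hgal hnondeg).2 m
  -- `T` is fixed by the twisted action of `D_𝔭`, hence plainly by `D_𝔭 ∩ ker κ`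
  have hT : ∀ d : absoluteGaloisGroup K, d ∈ decomp 𝔭 → d ∈ κ.kerSubgroup →
      d • (AddSubgroup.inclusion (Literature.Barriers.BirchSwinnertonDyer.geomTorsion_pow_le_geomPrimaryTorsion W p J) T) =
        AddSubgroup.inclusion (Literature.Barriers.BirchSwinnertonDyer.geomTorsion_pow_le_geomPrimaryTorsion W p J) T := by
    intro d hd hdk
    obtain ⟨σ, hσ⟩ := (mem_decomp_iff 𝔭 d).mp hd
    have h1 := hm σ
    rw [hσ] at h1
    have h1' : W.twistedWeilDual p κ J hu hu' huu' e hμ hadd₁ hadd₂ hgal (W.twistedTorsionGaloisModule p κ J u' hu' d T) =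
        W.twistedWeilDual p κ J hu hu' huu' e hμ hadd₁ hadd₂ hgal T :=
      (ContIntertwiningMap.isIntertwining (W.twistedWeilDual p κ J hu hu' huu' e hμ hadd₁ hadd₂ hgal) d T).trans h1
    have h2 : W.twistedTorsionGaloisModule p κ J u' hu' d T = T :=
      (W.twistedWeilDual_bijective p κ J hu hu' huu' e hμ hadd₁ hadd₂ hgal hnondeg).1 h1'
    rw [ZpExtension.galoisTwist_apply_of_mem_kerSubgroup _ _ _ _ _ _ hdk, torsionGaloisModule_apply_apply] at h2
    exact Subtype.ext (by
      have := congrArg Subtype.val h2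
      rw [AddSubgroup.coe_inclusion]
      rw [Literature.NumberTheory.EllipticCurves.AddSubgroup.torsionBy.coe_smul] at this
      rw [Literature.NumberTheory.EllipticCurves.primaryComponent.coe_smul, AddSubgroup.coe_inclusion]
      exact this)
  have hkill := hm₀ _ hT
  have hkill' : ((p ^ m₀ : ℕ) : ℤ) • T = 0 := by
    apply Subtype.ext
    have := congrArg Subtype.val hkill
    rw [AddSubmonoidClass.coe_nsmul, AddSubgroup.coe_inclusion] at this
    rw [AddSubgroupClass.coe_zsmul, natCast_zsmul]
    exact this
  rw [← map_zsmul, hkill', map_zero]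

end Summit.BirchSwinnertonDyer.BirchSwinnertonDyer.Theorems.UniversalToricDescentTwistedDescent

end
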